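import Summits.NavierStokesRegularity.NavierStokesRegularity.Theorems.GaldiLiouvilleGateParabolicGaldiLiouvilleTightness
import Summits.NavierStokesRegularity.NavierStokesRegularity.Theorems.GaldiLiouvilleGateParabolicGaldiLiouvilleTightnessSharp
import Summits.NavierStokesRegularity.NavierStokesRegularity.Theorems.GaldiLiouvilleGateParabolicGaldiLiouvilleL3Corner
import Summits.NavierStokesRegularity.NavierStokesRegularity.Theorems.GaldiLiouvilleGateParabolicGaldiLiouvilleSelfSimilarGate
import HarnessLib

/-!
# Crux `ParabolicGaldiLiouville` (stmt-NavierStokesRegularity-0893): `¬ X2` MODULO a nontrivial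
# D-solution (the route's kill criterion, in Lean)

Negative-side helper of the line lead of the birth line (theorems only; no sorry, standard
axioms). Nothing is refuted here: the hypothesis `H = GaldiLiouvilleGate.NontrivialDSolutionExists`
(route item stmt-NavierStokesRegularity-0898, "some `ν > 0` admits a smooth steady Navier–Stokes
solution `U ≢ 0` on `ℝ³` with `∫|∇U|² < ∞` and `U → 0` at infinity" — the negation of Leray's
Liouville problem, crux 0895) is an OPEN construction target. The file records the route's kill
criterion ("NontrivialDSolutionExists proved refutes X_G, X2 and (L) at once") as theorems:

* `GaldiLiouville_false_of_NontrivialDSolutionExists : NontrivialDSolutionExists → ¬ GaldiLiouville`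
  (definitional);
* `ParabolicGaldiLiouville_false_of_NontrivialDSolutionExists :
    NontrivialDSolutionExists → ¬ ParabolicGaldiLiouville` — through the landed containment
  `galdiLiouville_of_parabolicGaldiLiouville` (`…Tightness.lean`): a nontrivial D-solution, with its
  viscosity normalised to `1`, is a time-independent inhabitant of the class of X2;
* `stub_finiteDissipation_false_of_NontrivialDSolutionExists` — the same witness kills the line's
  one open stub (through `galdiLiouville_of_finiteDissipation`): its total dissipation over
  `(−∞, 0)` is `(+∞) · ∫|∇U|² = +∞`.
* `stub_twoGate_false_of_NontrivialDSolutionExists`,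
  `stub_sharpTwoGate_false_of_NontrivialDSolutionExists` (lead c2, reshapings 3–4) — likewise for
  the weakened two-gate stubs (through `galdiLiouville_of_twoGate`, `galdiLiouville_of_sharpTwoGate`).
-/

noncomputable section

set_option linter.dupNamespace false

namespace Summit.NavierStokesRegularity.NavierStokesRegularity.Theorems.ParabolicGaldiLiouville.Birth

open MeasureTheory Filter Topology Set Function
open scoped ENNReal NNReal
open Literature.Analysis.FluidPDE

/-- **A nontrivial D-solution refutes Galdi's Liouville statement** (definitional: the witness of
`NontrivialDSolutionExists` satisfies every hypothesis of `GaldiLiouville` and is `≠ 0`). -/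
theorem GaldiLiouville_false_of_NontrivialDSolutionExists
    (hH : Theses.GaldiLiouvilleGate.NontrivialDSolutionExists) :
    ¬ Theses.GaldiLiouvilleGate.GaldiLiouville := by
  intro hG
  obtain ⟨ν, hν, U, P, hprof, hU, hP, hD, h0, hne⟩ := hH
  exact hne (hG ν hν U P hprof hU hP hD h0)

/-- **`¬ X2` modulo a nontrivial D-solution: `NontrivialDSolutionExists → ¬ ParabolicGaldiLiouville`.**
The route's kill criterion for the crux, through the landed containment
`galdiLiouville_of_parabolicGaldiLiouville : ParabolicGaldiLiouville → GaldiLiouville`: a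
nontrivial D-solution (viscosity normalised to `1`, extended constantly in time) is a nontrivial
smooth bounded ancient mild solution with constant finite enstrophy and `L⁶` slices. The
hypothesis is the open construction target stmt-NavierStokesRegularity-0898; nothing is refuted
unconditionally. -/
theorem ParabolicGaldiLiouville_false_of_NontrivialDSolutionExists
    (hH : Theses.GaldiLiouvilleGate.NontrivialDSolutionExists) :
    ¬ Theses.GaldiLiouvilleGate.ParabolicGaldiLiouville := fun hX2 =>
  GaldiLiouville_false_of_NontrivialDSolutionExists hH (galdiLiouville_of_parabolicGaldiLiouville hX2)

/-- **The same witness kills the line's open stub: `NontrivialDSolutionExists →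
¬ stub_finiteDissipation`** (through the landed `galdiLiouville_of_finiteDissipation`: a steady
inhabitant of the class of X2 dissipates `∫|∇W|² > 0` per unit time, so its total dissipation over
`(−∞, 0)` is infinite). The statement negated is verbatim the registered stub
`stub_finiteDissipation` of crux stmt-NavierStokesRegularity-0893. -/
theorem stub_finiteDissipation_false_of_NontrivialDSolutionExists
    (hH : Theses.GaldiLiouvilleGate.NontrivialDSolutionExists) :
    ¬ (∀ v : ℝ → EuclideanSpace ℝ (Fin 3) → EuclideanSpace ℝ (Fin 3),
      Literature.Analysis.FluidPDE.IsBoundedAncientMildSolution 1 v →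
      ContDiffOn ℝ (⊤ : ℕ∞) (Function.uncurry v) (Set.Iio 0 ×ˢ Set.univ) →
      (∃ C : NNReal, ∀ s < 0, ∫⁻ y, ENNReal.ofReal
          (Literature.Analysis.FluidPDE.frobeniusNormSq (fderiv ℝ (v s) y)) ≤ C) →
      (∀ s < 0, MeasureTheory.MemLp (v s) 6 MeasureTheory.volume) →
      (∫⁻ s in Set.Iio 0, ∫⁻ y, ENNReal.ofReal
          (Literature.Analysis.FluidPDE.frobeniusNormSq (fderiv ℝ (v s) y))) < ⊤) := fun hstub =>
  GaldiLiouville_false_of_NontrivialDSolutionExists hH (galdiLiouville_of_finiteDissipation hstub)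

/-- **The same witness kills the line's SHARP open stub (lead c1, reshaping 2):
`NontrivialDSolutionExists → ¬ stub_sqIntegrableEnstrophy`** (through the landed
`galdiLiouville_of_sqIntegrableEnstrophy`: a steady inhabitant of the class of X2 has the constant
enstrophy `∫|∇W|² > 0`, whose square is not integrable over `(−∞, 0)`). The statement negated is
verbatim the registered stub `stub_sqIntegrableEnstrophy` of crux stmt-NavierStokesRegularity-0893. -/
theorem stub_sqIntegrableEnstrophy_false_of_NontrivialDSolutionExists
    (hH : Theses.GaldiLiouvilleGate.NontrivialDSolutionExists) :
    ¬ (∀ v : ℝ → EuclideanSpace ℝ (Fin 3) → EuclideanSpace ℝ (Fin 3),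
      Literature.Analysis.FluidPDE.IsBoundedAncientMildSolution 1 v →
      ContDiffOn ℝ (⊤ : ℕ∞) (Function.uncurry v) (Set.Iio 0 ×ˢ Set.univ) →
      (∃ C : NNReal, ∀ s < 0, ∫⁻ y, ENNReal.ofReal
          (Literature.Analysis.FluidPDE.frobeniusNormSq (fderiv ℝ (v s) y)) ≤ C) →
      (∀ s < 0, MeasureTheory.MemLp (v s) 6 MeasureTheory.volume) →
      (∫⁻ s in Set.Iio 0, (∫⁻ y, ENNReal.ofReal
          (Literature.Analysis.FluidPDE.frobeniusNormSq (fderiv ℝ (v s) y))) ^ 2) < ⊤) :=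
  fun hstub =>
  GaldiLiouville_false_of_NontrivialDSolutionExists hH (galdiLiouville_of_sqIntegrableEnstrophy hstub)

/-- **The same witness kills the TWO-GATE open stub of reshaping 3 (lead c2):
`NontrivialDSolutionExists → ¬ stub_twoGate`** (through the landed `galdiLiouville_of_twoGate`,
`…L3Corner.lean`: for the steady inhabitant of the class, gate 1 forces zero Dirichlet integral and
gate 2 puts it in `L³`, where Albritton–Barker's Thm 1.2 applies). The statement negated is
verbatim the registered (now superseded) stub `stub_twoGate` of crux stmt-NavierStokesRegularity-0893. -/
theorem stub_twoGate_false_of_NontrivialDSolutionExists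
    (hH : Theses.GaldiLiouvilleGate.NontrivialDSolutionExists) :
    ¬ (∀ v : ℝ → EuclideanSpace ℝ (Fin 3) → EuclideanSpace ℝ (Fin 3),
      Literature.Analysis.FluidPDE.IsBoundedAncientMildSolution 1 v →
      ContDiffOn ℝ (⊤ : ℕ∞) (Function.uncurry v) (Set.Iio 0 ×ˢ Set.univ) →
      (∃ C : NNReal, ∀ s < 0, ∫⁻ y, ENNReal.ofReal
          (Literature.Analysis.FluidPDE.frobeniusNormSq (fderiv ℝ (v s) y)) ≤ C) →
      (∀ s < 0, MeasureTheory.MemLp (v s) 6 MeasureTheory.volume) →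
      (∫⁻ s in Set.Iio 0, (∫⁻ y, ENNReal.ofReal
          (Literature.Analysis.FluidPDE.frobeniusNormSq (fderiv ℝ (v s) y))) ^ 2) < ⊤ ∨
      (∃ (τ : ℕ → ℝ) (M : ENNReal), M < ⊤ ∧ Filter.Tendsto τ Filter.atTop Filter.atBot ∧
        (∀ k, τ k < 0) ∧ ∀ k, MeasureTheory.eLpNorm (v (τ k)) 3 MeasureTheory.volume ≤ M)) :=
  fun hstub =>
  GaldiLiouville_false_of_NontrivialDSolutionExists hH (galdiLiouville_of_twoGate hstub)

/-- **The same witness kills the SHARP TWO-GATE open stub of reshaping 4 (lead c2):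
`NontrivialDSolutionExists → ¬ stub_sharpTwoGate`** (through the landed
`galdiLiouville_of_sharpTwoGate`, `…SelfSimilarGate.lean`: the steady inhabitant has constant
nonzero `‖·‖₆` and so fails the self-similar-rate liminf gate A, while gate B puts it in `L³`).
The statement negated is verbatim the registered open stub `stub_sharpTwoGate` of crux
stmt-NavierStokesRegularity-0893. -/
theorem stub_sharpTwoGate_false_of_NontrivialDSolutionExists
    (hH : Theses.GaldiLiouvilleGate.NontrivialDSolutionExists) :
    ¬ (∀ v : ℝ → EuclideanSpace ℝ (Fin 3) → EuclideanSpace ℝ (Fin 3),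
      Literature.Analysis.FluidPDE.IsBoundedAncientMildSolution 1 v →
      ContDiffOn ℝ (⊤ : ℕ∞) (Function.uncurry v) (Set.Iio 0 ×ˢ Set.univ) →
      (∃ C : NNReal, ∀ s < 0, ∫⁻ y, ENNReal.ofReal
          (Literature.Analysis.FluidPDE.frobeniusNormSq (fderiv ℝ (v s) y)) ≤ C) →
      (∀ s < 0, MeasureTheory.MemLp (v s) 6 MeasureTheory.volume) →
      (∀ ε : ENNReal, 0 < ε → ∀ R : ℝ, 0 < R → ∃ σ : ℝ, σ < -R ∧
        MeasureTheory.eLpNorm (v σ) 6 MeasureTheory.volume ^ (4 : ℝ) * ENNReal.ofReal (-σ) < ε) ∨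
      (∃ (τ : ℕ → ℝ) (M : ENNReal), M < ⊤ ∧ Filter.Tendsto τ Filter.atTop Filter.atBot ∧
        (∀ k, τ k < 0) ∧ ∀ k, MeasureTheory.eLpNorm (v (τ k)) 3 MeasureTheory.volume ≤ M)) :=
  fun hstub =>
  GaldiLiouville_false_of_NontrivialDSolutionExists hH (galdiLiouville_of_sharpTwoGate hstub)

end Summit.NavierStokesRegularity.NavierStokesRegularity.Theorems.ParabolicGaldiLiouville.Birth

end
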